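import Mathlib
import Summits.Ventures.PercRepro2.TwoTypedAbstract

/-!
# Two typed edges, II: the bridge to configurations (blind cell PercRepro2, night-3, 2026-08-24)

* `pt`: the points `a₁, a₂, o, b, a₃` followed by a list `xs` (the ends of the typed edges);
  `lab`: the least-representative label of a point (`Nat.find`), `lab_eq_iff` (labels agree iff
  the points are connected), `lab_le`, `lab_idem`, `lab_zero`;
* `conn_update_lab`: a labelling describing `Conn` on the points describes, after merging the
  labels of the ends of an opened edge, `Conn` in the updated configuration
  (`OneEdge.conn_update_true_iff` + `mrg_eq_iff`);
* `st_eq_stL`: the state through a labelling; `valid_st`: real states are realisable;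
  `K3_zero_x`: `K₃` vanishes when `Q` fails;
* `typedCount_pair`: the typed count over `{e₁, e₂}` as the sum over the `z[e₁ ↦ cᵢ][e₂ ↦ dᵢ]`
  with the prescribed open counts (`sum_agree_off_pair`).
-/

namespace Summit.Ventures.PercRepro2

open UnionCluster

namespace CovForm

namespace TwoTyped

open OneTyped

/-! ## The bridge: points, least-representative labels, the states of the merges -/

section Bridge

open Classical

variable {V : Type*} {E : Type*} {R : Type*} [Field R]
variable (ends : E → Sym2 V) (o a₁ a₂ a₃ b : V) (xs : List V)

/-- The points: `a₁, a₂, o, b, a₃`, then the list `xs` (the ends of the typed edges). -/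
def pt : ℕ → V
  | 0 => a₁ | 1 => a₂ | 2 => o | 3 => b | 4 => a₃ | n + 5 => xs.getD n a₁

/-- The least-representative label of the point `i` in `ω`: the least `j` with `pt j ∼ pt i`. -/
noncomputable def lab (ω : Config E) (i : ℕ) : ℕ :=
  Nat.find (⟨i, conn_refl ends ω (pt o a₁ a₂ a₃ b xs i)⟩ :
    ∃ j, Conn ends ω (pt o a₁ a₂ a₃ b xs j) (pt o a₁ a₂ a₃ b xs i))

/-- The representative of a point is connected to it. -/
lemma lab_spec (ω : Config E) (i : ℕ) : Conn ends ω (pt o a₁ a₂ a₃ b xs (lab ends o a₁ a₂ a₃ b xs ω i)) (pt o a₁ a₂ a₃ b xs i) :=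
  Nat.find_spec (p := fun j => Conn ends ω (pt o a₁ a₂ a₃ b xs j) (pt o a₁ a₂ a₃ b xs i)) ⟨i, conn_refl ends ω (pt o a₁ a₂ a₃ b xs i)⟩

/-- The label of a point is at most its index. -/
lemma lab_le (ω : Config E) (i : ℕ) : lab ends o a₁ a₂ a₃ b xs ω i ≤ i :=
  Nat.find_min' (p := fun j => Conn ends ω (pt o a₁ a₂ a₃ b xs j) (pt o a₁ a₂ a₃ b xs i)) ⟨i, conn_refl ends ω (pt o a₁ a₂ a₃ b xs i)⟩
    (conn_refl ends ω (pt o a₁ a₂ a₃ b xs i))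

/-- Connected points carry the same label. -/
lemma lab_eq_of_conn (ω : Config E) {p q : ℕ} (h : Conn ends ω (pt o a₁ a₂ a₃ b xs p) (pt o a₁ a₂ a₃ b xs q)) : lab ends o a₁ a₂ a₃ b xs ω p = lab ends o a₁ a₂ a₃ b xs ω q :=
  le_antisymm
    (Nat.find_min' (p := fun j => Conn ends ω (pt o a₁ a₂ a₃ b xs j) (pt o a₁ a₂ a₃ b xs p)) ⟨p, conn_refl ends ω (pt o a₁ a₂ a₃ b xs p)⟩
      (conn_trans (lab_spec ends o a₁ a₂ a₃ b xs ω q) (conn_symm h)))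
    (Nat.find_min' (p := fun j => Conn ends ω (pt o a₁ a₂ a₃ b xs j) (pt o a₁ a₂ a₃ b xs q)) ⟨q, conn_refl ends ω (pt o a₁ a₂ a₃ b xs q)⟩
      (conn_trans (lab_spec ends o a₁ a₂ a₃ b xs ω p) h))

/-- Labels agree exactly when the points are connected. -/
lemma lab_eq_iff (ω : Config E) (p q : ℕ) : lab ends o a₁ a₂ a₃ b xs ω p = lab ends o a₁ a₂ a₃ b xs ω q ↔ Conn ends ω (pt o a₁ a₂ a₃ b xs p) (pt o a₁ a₂ a₃ b xs q) :=
  ⟨fun h => conn_trans (conn_symm (h ▸ lab_spec ends o a₁ a₂ a₃ b xs ω p))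
    (lab_spec ends o a₁ a₂ a₃ b xs ω q), lab_eq_of_conn ends o a₁ a₂ a₃ b xs ω⟩

/-- The first point carries the label `0`. -/
lemma lab_zero (ω : Config E) : lab ends o a₁ a₂ a₃ b xs ω 0 = 0 := Nat.le_zero.mp (lab_le ends o a₁ a₂ a₃ b xs ω 0)

/-- A label is a fixed point of the labelling (the least-representative property). -/
lemma lab_idem (ω : Config E) (i : ℕ) : lab ends o a₁ a₂ a₃ b xs ω (lab ends o a₁ a₂ a₃ b xs ω i) = lab ends o a₁ a₂ a₃ b xs ω i :=
  lab_eq_of_conn ends o a₁ a₂ a₃ b xs ω (lab_spec ends o a₁ a₂ a₃ b xs ω i)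

/-- A labelling describing `Conn` on the points describes, after merging the labels of the two
ends of an opened edge, `Conn` in the updated configuration (`OneEdge.conn_update_true_iff`). -/
lemma conn_update_lab [DecidableEq E] (ω : Config E) (f : ℕ → ℕ)
    (hf : ∀ p q, f p = f q ↔ Conn ends ω (pt o a₁ a₂ a₃ b xs p) (pt o a₁ a₂ a₃ b xs q))
    {e : E} {i j : ℕ} (hends : ends e = s(pt o a₁ a₂ a₃ b xs i, pt o a₁ a₂ a₃ b xs j)) (p q : ℕ) :
    mrg (f i) (f j) (f p) = mrg (f i) (f j) (f q) ↔
      Conn ends (Function.update ω e true) (pt o a₁ a₂ a₃ b xs p) (pt o a₁ a₂ a₃ b xs q) := by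
  rw [OneEdge.conn_update_true_iff hends, mrg_eq_iff, hf p q, hf p i, hf j q, hf p j, hf i q]

/-- The state through a labelling. -/
lemma st_eq_stL (ω : Config E) (f : ℕ → ℕ) (hf : ∀ p q, f p = f q ↔ Conn ends ω (pt o a₁ a₂ a₃ b xs p) (pt o a₁ a₂ a₃ b xs q)) :
    st ends o a₁ a₂ a₃ b ω = stL (f 0) (f 1) (f 2) (f 3) (f 4) := by
  simp only [st, stL, Prod.mk.injEq, decide_eq_decide]
  exact ⟨(hf 1 0).symm, (hf 0 2).symm, (hf 1 2).symm, (hf 0 3).symm, (hf 1 3).symm,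
    (hf 0 4).symm, (hf 1 4).symm⟩

/-- Realisability from the three exclusions. -/
lemma valid_of (s : St) (h : s.q' = true ∨
    ((s.Lo = true → s.Ho = true → False) ∧ (s.Lb = true → s.Hb = true → False) ∧
      (s.L3 = true → s.H3 = true → False))) : valid s = true := by
  unfold valid
  rcases s with ⟨q, lo, ho, lb, hb, l3, h3⟩
  simp only [St.q', St.Lo, St.Ho, St.Lb, St.Hb, St.L3, St.H3] at h ⊢
  cases q <;> cases lo <;> cases ho <;> cases lb <;> cases hb <;> cases l3 <;> cases h3 <;> simp_all

/-- Real states are realisable: a mark in both root clusters joins the roots. -/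
lemma valid_st (ω : Config E) : valid (st ends o a₁ a₂ a₃ b ω) = true := by
  apply valid_of
  by_cases hq : Conn ends ω a₂ a₁
  · exact Or.inl (by simp [st, St.q', hq])
  · refine Or.inr ⟨?_, ?_, ?_⟩
    · intro h1 h2
      simp only [st, St.Lo, St.Ho, decide_eq_true_eq] at h1 h2
      exact hq (conn_trans h2 (conn_symm h1))
    · intro h1 h2
      simp only [st, St.Lb, St.Hb, decide_eq_true_eq] at h1 h2
      exact hq (conn_trans h2 (conn_symm h1))
    · intro h1 h2
      simp only [st, St.L3, St.H3, decide_eq_true_eq] at h1 h2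
      exact hq (conn_trans h2 (conn_symm h1))

/-- `K₃` vanishes when `Q` fails in the first copy. -/
lemma K3_zero_x {x : Config E} (hx : Conn ends x a₂ a₁) (y w : Config E) :
    K3 ends o a₁ a₂ a₃ b x y w = (0 : R) := by
  rw [K3_eq_KB]
  have hq : (st ends o a₁ a₂ a₃ b x).q' = true := by simp [st, St.q', hx]
  rw [KB_eq_zero_of_q' _ _ _ (Or.inl hq), Int.cast_zero]

end Bridge

/-! ## The typed count with two typed edges -/

section SumLemma

variable {E : Type*} [Fintype E] [DecidableEq E] {R : Type*} [CommRing R]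

omit [Fintype E] in
/-- Agreeing with `z` off `{e₁, e₂}` means being `z` updated at `e₁` and `e₂`. -/
lemma agree_off_pair_iff (z x : Config E) (e₁ e₂ : E) :
    (∀ e, e ∉ ({e₁, e₂} : Finset E) → x e = z e) ↔
      x = Function.update (Function.update z e₁ (x e₁)) e₂ (x e₂) := by
  constructor
  · intro h
    funext e
    by_cases h2 : e = e₂
    · subst h2; simp
    · rw [Function.update_of_ne h2]
      by_cases h1 : e = e₁
      · subst h1; simp
      · rw [Function.update_of_ne h1]
        exact h e (by simp [h1, h2])
  · intro h e he
    have h1 : e ≠ e₁ := fun h' => he (by simp [h'])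
    have h2 : e ≠ e₂ := fun h' => he (by simp [h'])
    conv_lhs => rw [h]
    rw [Function.update_of_ne h2, Function.update_of_ne h1]

/-- Summing a function over the configurations agreeing with `z` off `{e₁, e₂}`. -/
lemma sum_agree_off_pair (z : Config E) (e₁ e₂ : E) (hne : e₁ ≠ e₂) (P : Config E → Prop)
    [DecidablePred P]
    (hP : ∀ x, P x ↔ x = Function.update (Function.update z e₁ (x e₁)) e₂ (x e₂))
    (φ : Config E → R) :
    (∑ x : Config E, if P x then φ x else 0) =
      ∑ c : Bool, ∑ d : Bool, φ (Function.update (Function.update z e₁ c) e₂ d) := by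
  rw [← Finset.sum_filter]
  have hset : Finset.univ.filter P = Finset.univ.image
      (fun cd : Bool × Bool => Function.update (Function.update z e₁ cd.1) e₂ cd.2) := by
    ext x
    simp only [Finset.mem_filter, Finset.mem_univ, true_and, Finset.mem_image, hP]
    constructor
    · intro h
      exact ⟨(x e₁, x e₂), h.symm⟩
    · rintro ⟨⟨c, d⟩, rfl⟩
      simp [Function.update_of_ne hne]
  rw [hset, Finset.sum_image, Fintype.sum_prod_type]
  intro cd _ cd' _ h
  have h1 := congrArg (fun f => f e₁) h
  have h2 := congrArg (fun f => f e₂) h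
  simp [Function.update_of_ne hne] at h1 h2
  exact Prod.ext h1 h2

/-- **Two typed edges**: the typed count over `F = {e₁, e₂}` is the sum over the triples
`(z[e₁ ↦ cᵢ][e₂ ↦ dᵢ])` with the prescribed open counts. -/
theorem typedCount_pair (z : Config E) (e₁ e₂ : E) (hne : e₁ ≠ e₂) (τ : E → ℕ)
    (K : Config E → Config E → Config E → R) :
    typedCount {e₁, e₂} z τ K =
      ∑ c₁ : Bool, ∑ d₁ : Bool, ∑ c₂ : Bool, ∑ d₂ : Bool, ∑ c₃ : Bool, ∑ d₃ : Bool,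
        if c₁.toNat + c₂.toNat + c₃.toNat = τ e₁ ∧ d₁.toNat + d₂.toNat + d₃.toNat = τ e₂ then
          K (Function.update (Function.update z e₁ c₁) e₂ d₁)
            (Function.update (Function.update z e₁ c₂) e₂ d₂)
            (Function.update (Function.update z e₁ c₃) e₂ d₃) else 0 := by
  unfold typedCount
  have hcond : ∀ x y w : Config E,
      ((∀ e', e' ∉ ({e₁, e₂} : Finset E) → x e' = z e' ∧ y e' = z e' ∧ w e' = z e') ∧
        (∀ e' ∈ ({e₁, e₂} : Finset E), openCount x y w e' = τ e')) ↔
      (x = Function.update (Function.update z e₁ (x e₁)) e₂ (x e₂) ∧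
        (y = Function.update (Function.update z e₁ (y e₁)) e₂ (y e₂) ∧
        (w = Function.update (Function.update z e₁ (w e₁)) e₂ (w e₂) ∧
        (openCount x y w e₁ = τ e₁ ∧ openCount x y w e₂ = τ e₂)))) := by
    intro x y w
    simp only [Finset.forall_mem_insert, Finset.mem_singleton, forall_eq, imp_and, forall_and]
    rw [agree_off_pair_iff, agree_off_pair_iff, agree_off_pair_iff]
    tauto
  simp only [hcond, sum_ite_const, ite_and]
  rw [sum_agree_off_pair z e₁ e₂ hne _ (fun x => Iff.rfl)]
  refine Finset.sum_congr rfl fun c₁ _ => ?_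
  refine Finset.sum_congr rfl fun d₁ _ => ?_
  rw [sum_agree_off_pair z e₁ e₂ hne _ (fun x => Iff.rfl)]
  refine Finset.sum_congr rfl fun c₂ _ => ?_
  refine Finset.sum_congr rfl fun d₂ _ => ?_
  rw [sum_agree_off_pair z e₁ e₂ hne _ (fun x => Iff.rfl)]
  refine Finset.sum_congr rfl fun c₃ _ => ?_
  simp only [openCount, Function.update_self, Function.update_of_ne hne, sum_ite_const]

end SumLemma

end TwoTyped

end CovForm

end Summit.Ventures.PercRepro2
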